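import Summits.HodgeConjecture.CorCM.GaloisOddPrimeShapes
import Summits.HodgeConjecture.CorCM.TwoGroupQuaternionRelations
import Summits.HodgeConjecture.CorCM.GaloisDicyclicAllTypes
import Summits.HodgeConjecture.CorCM.CyclicCMFieldsAllTypes
import HarnessLib

/-!
# THE TWO UNCONDITIONALLY GOOD SHAPES: `C(1)` (cyclic `C_{2ⁿp}`) and `Dic` (the dicyclic group `Dic_{2ⁿ⁻²p}`) — the Hodge conjecture
# for every power of every abelian variety with CM by such a field

COR-CM (cell `pub-hodgecm2`), binder seat b04 (gen 38), count-neutral own lane «Galois-CM-type classification».  KERNEL ONLY: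
theorems; no definition, no named fact, no `sorry`.  `HC_CM` is neither used nor claimed.

`CorCM/GaloisOddPrimeShapes` lists the five shapes of the Galois group of a GOOD Galois CM field of degree `2ⁿ·p`: `⟨u⟩ ⋊ ⟨x⟩` with
`x u x⁻¹ = uʳ` (shape C(r)), and `⟨u⟩ ⋊ ⟨a, x⟩`, `⟨a, x⟩ ≅ Q_{2ⁿ}`, with `(a, x)` acting on `u` by `(1, 1)` (Q×), `(1, −1)` (Dic) or
`(−1, 1)` (QK).  Two of them are identified here with groups the lane has already classified:
* shape **C(1)** (`x` centralises `u`): `u x` has order `2ⁿ p = |Gal|`, so `Gal(K/ℚ)` is CYCLIC of order `2ⁿ·p` with `p` prime —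
  GOOD for ALL abelian varieties (gens 12–21 `CyclicAllTypes`): `isCyclic_of_shape_C_one`, `hodgeConjectureFor_pow_of_shape_C_one`;
* shape **Dic** (`a` centralises, `x` inverts `u`): with `A = u a` of order `2ⁿ⁻¹ p`, `x A x⁻¹ = A⁻¹`, `x² = A^{2ⁿ⁻² p}`, gen 34's
  `UniqueInvolution… / nonempty_mulEquiv_quaternionGroup_of_relations` gives `Gal(K/ℚ) ≃* QuaternionGroup (2ⁿ⁻² p) = Dic_{2ⁿ⁻² p}`,
  GOOD for ALL abelian varieties since the odd part `p` is prime (gen 20 `GaloisDicyclic`): `nonempty_mulEquiv_quaternionGroup_of_shape_dic`,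
  `hodgeConjectureFor_pow_of_shape_dic`.
The remaining shapes C(r) (`r ≢ 1`), Q× (`Q_{2ⁿ} × C_p`) and QK are the ARITHMETIC residue of the classification (gens 25–30).

## References

* [Shimura1998] G. Shimura, *Abelian Varieties with Complex Multiplication and Modular Functions*, §5.1 Prop. 3, §6.2 Thm. 3, §8.2 Prop. 26.
* [Gordon1999HodgeAVSurvey] B. B. Gordon, *A survey of the Hodge conjecture for abelian varieties*, Thm. 6.4, §9.3, §9.4.3.
* [Kubota1965] T. Kubota, *On the field extension by complex multiplication*, Trans. AMS 118 (1965), §4 Lemma 2.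
* [Rotman1995] J. J. Rotman, *An Introduction to the Theory of Groups*, 4th ed., GTM 148, Thm. 4.3 (and the dicyclic presentation).
-/

noncomputable section

open CategoryTheory CategoryTheory.Limits NumberField
open scoped BigOperators

namespace Summit.HodgeConjecture.CorCM.GaloisModels

open Literature.NumberTheory.ComplexMultiplication Literature.AlgebraicGeometry.HodgeTheory
open Literature.AlgebraicGeometry.Motives (AbelianVariety CMType)
open Literature.AlgebraicGeometry.ComplexMultiplication (IsCMTypeRealisation)
open Literature.AlgebraicGeometry.Pohlmann1968 Summit.HodgeConjecture.CorCM.GaloisRank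

/-! ## §1 Group lemmas -/

section Group

variable {G : Type*} [Group G] [Finite G]

/-- **Shape C(1) is cyclic**: commuting `u, x` of coprime orders `p`, `2ⁿ` with `|G| = 2ⁿ p` ⟹ `G` cyclic (generated by `u x`).
[cite: Rotman1995, Thm. 4.3] -/
theorem isCyclic_of_commute_of_coprime {u x : G} {p n : ℕ} (hp : Odd p) (hou : orderOf u = p) (hox : orderOf x = 2 ^ n)
    (hux : Commute u x) (hcard : Nat.card G = 2 ^ n * p) : IsCyclic G := by
  have hcop : Nat.Coprime (orderOf u) (orderOf x) := by
    rw [hou, hox]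
    exact Nat.Coprime.pow_right _ (Nat.coprime_two_left.2 hp).symm
  have h := hux.orderOf_mul_eq_mul_orderOf_of_coprime hcop
  rw [hou, hox, mul_comm] at h
  exact isCyclic_of_orderOf_eq_card (u * x) (by rw [h, hcard])

/-- **Shape Dic is dicyclic**: `u` of odd prime order `p` commuting with `a` of order `2^{k+1}`, `x` inverting `u` and `a`,
`x² = a^{2^k}`, `|G| = 2^{k+2} p` ⟹ `G ≃* QuaternionGroup (2^k p)` (`= Dic_{2^k p}`), via `A = u a`. [cite: Rotman1995, Thm. 4.3] -/
theorem nonempty_mulEquiv_quaternionGroup_of_dic_relations {u a x : G} {p k : ℕ} (hp : p.Prime) (hp2 : p ≠ 2)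
    (hou : orderOf u = p) (hoa : orderOf a = 2 ^ (k + 1)) (hua : a * u * a⁻¹ = u) (hxu : x * u * x⁻¹ = u⁻¹)
    (hxa : x * a = a⁻¹ * x) (hxx : x * x = a ^ 2 ^ k) (hcard : Nat.card G = 2 ^ (k + 2) * p) :
    Nonempty (G ≃* QuaternionGroup (2 ^ k * p)) := by
  classical
  haveI : NeZero (2 ^ k * p) := ⟨Nat.pos_iff_ne_zero.1 (Nat.mul_pos (pow_pos two_pos _) hp.pos)⟩
  have hcomm : Commute u a := by
    change u * a = a * u
    calc u * a = a * u * a⁻¹ * a := by rw [hua]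
      _ = a * u := by group
  have hcop : Nat.Coprime (orderOf u) (orderOf a) := by
    rw [hou, hoa]
    exact Nat.Coprime.pow_right _ (Nat.coprime_two_left.2 (hp.odd_of_ne_two hp2)).symm
  have hoA : orderOf (u * a) = 2 * (2 ^ k * p) := by
    rw [hcomm.orderOf_mul_eq_mul_orderOf_of_coprime hcop, hou, hoa]; ring
  -- `x` inverts `A = u a`
  have hxA : x * (u * a) * x⁻¹ = (u * a)⁻¹ := by
    calc x * (u * a) * x⁻¹ = (x * u * x⁻¹) * (x * a * x⁻¹) := by group
      _ = u⁻¹ * a⁻¹ := by rw [hxu, hxa, mul_inv_cancel_right]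
      _ = (u * a)⁻¹ := by rw [hcomm.eq, mul_inv_rev]
  have hxA' : x ∉ Subgroup.zpowers (u * a) := fun hx => by
    -- then `x` commutes with `A`, so `A = A⁻¹`, `A² = 1`: impossible, `A` has order `2^{k+1} p ≥ 4`
    obtain ⟨j, hj⟩ := Subgroup.mem_zpowers_iff.1 hx
    have hcx : Commute x (u * a) := by rw [← hj]; exact (Commute.refl (u * a)).zpow_left j
    have hc : x * (u * a) * x⁻¹ = u * a := by rw [hcx.eq, mul_inv_cancel_right]
    have h2 : (u * a) ^ 2 = 1 := by
      rw [pow_two]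
      nth_rewrite 2 [← hc]
      rw [hxA, mul_inv_cancel]
    have hd : orderOf (u * a) ∣ 2 := orderOf_dvd_of_pow_eq_one h2
    rw [hoA] at hd
    have h3 := Nat.le_of_dvd two_pos hd
    have h4 : 1 * 2 ≤ 2 ^ k * p := Nat.mul_le_mul (Nat.one_le_two_pow) hp.two_le
    omega
  -- `x² = A^{2^k p}`
  have h2 : (x * x) ^ 2 = 1 := by
    rw [hxx, ← pow_mul, ← pow_succ, ← hoa]
    exact pow_orderOf_eq_one a
  have hu1 : u ^ (2 ^ k * p) = 1 := by rw [mul_comm, pow_mul, ← hou, pow_orderOf_eq_one, one_pow]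
  have ha1 : a ^ (2 ^ k * p) = x * x := by
    rw [pow_mul, ← hxx]
    obtain ⟨j, hj⟩ := hp.odd_of_ne_two hp2
    rw [hj, pow_succ, pow_mul, h2, one_pow, one_mul]
  have hxx' : x * x = (u * a) ^ (2 ^ k * p) := by rw [hcomm.mul_pow, hu1, one_mul, ha1]
  have hcard' : Nat.card G = 4 * (2 ^ k * p) := by rw [hcard]; ring
  exact UniqueInvolution.nonempty_mulEquiv_quaternionGroup_of_relations hcard' hoA hxA' hxA hxx'

end Group

/-! ## §2 Shape C(1): cyclic — GOOD for all abelian varieties -/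

variable {K : Type} [Field K] [NumberField K] [IsCMField K] [IsGalois ℚ K]

omit [IsCMField K] in
/-- **Shape C(1) ⟹ `Gal(K/ℚ)` cyclic.**  `[K:ℚ] = 2ⁿ·p` (`p` odd), `u` of order `p`, `x` of order `2ⁿ` with `x u x⁻¹ = u` ⟹ `Gal(K/ℚ)` is
cyclic. [cite: Rotman1995, Thm. 4.3] -/
theorem isCyclic_of_shape_C_one {n p : ℕ} (hdeg : Module.finrank ℚ K = 2 ^ n * p) (hp : Odd p) {u x : K ≃ₐ[ℚ] K}
    (hou : orderOf u = p) (hox : orderOf x = 2 ^ n) (hxu : x * u * x⁻¹ = u) : IsCyclic (K ≃ₐ[ℚ] K) := by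
  refine isCyclic_of_commute_of_coprime hp hou hox ?_ (by rw [IsGalois.card_aut_eq_finrank, hdeg])
  change u * x = x * u
  calc u * x = x * u * x⁻¹ * x := by rw [hxu]
    _ = x * u := by group

variable {Φ : CMType K} {A : AbelianVariety ℂ} {ι : 𝓞 K →+* End A} {θ : K →+* Module.End ℂ (complexBetti A.X 1)}

/-- **Shape C(1) is GOOD for ALL abelian varieties: the Hodge conjecture for every power of every abelian variety with CM by `K`**
(`[K:ℚ] = 2ⁿ·p`, `p` an odd prime, `n ≥ 1`, `Gal(K/ℚ) = ⟨u⟩ × ⟨x⟩` cyclic). [cite: Shimura1998, §5.1 Prop. 3, §6.2 Thm. 3 and §8.2 Prop. 26]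
[cite: Gordon1999HodgeAVSurvey, Thm. 6.4 and §9.4.3] [cite: Kubota1965, §4 Lemma 2] -/
theorem hodgeConjectureFor_pow_of_shape_C_one {n p : ℕ} (hdeg : Module.finrank ℚ K = 2 ^ n * p) (hn : 1 ≤ n) (hp : p.Prime)
    (hp2 : p ≠ 2) {u x : K ≃ₐ[ℚ] K} (hou : orderOf u = p) (hox : orderOf x = 2 ^ n) (hxu : x * u * x⁻¹ = u)
    (hA : IsCMTypeRealisation Φ A ι θ) (N : ℕ) : HodgeConjectureFor (⨁ fun _ : Fin N => A).dim (⨁ fun _ : Fin N => A).X := by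
  obtain ⟨n', rfl⟩ := Nat.exists_eq_add_of_le hn
  exact CyclicAllTypes.hodgeConjectureFor_pow_of_isCyclic_all (isCyclic_of_shape_C_one hdeg (hp.odd_of_ne_two hp2) hou hox hxu)
    (hp.odd_of_ne_two hp2) (Or.inr hp) (by rw [hdeg, add_comm]) hA N

/-- … and every abelian variety realising a CM type of `K` is STABLY NONDEGENERATE. [cite: Gordon1999HodgeAVSurvey, Thm. 6.4]
[cite: Kubota1965, §4 Lemma 2] -/
theorem isStablyNondegenerate_of_shape_C_one {n p : ℕ} (hdeg : Module.finrank ℚ K = 2 ^ n * p) (hn : 1 ≤ n) (hp : p.Prime)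
    (hp2 : p ≠ 2) {u x : K ≃ₐ[ℚ] K} (hou : orderOf u = p) (hox : orderOf x = 2 ^ n) (hxu : x * u * x⁻¹ = u)
    (hA : IsCMTypeRealisation Φ A ι θ) : IsStablyNondegenerate A := by
  obtain ⟨n', rfl⟩ := Nat.exists_eq_add_of_le hn
  exact CyclicAllTypes.isStablyNondegenerate_of_isCMTypeRealisation_of_isCyclic
    (isCyclic_of_shape_C_one hdeg (hp.odd_of_ne_two hp2) hou hox hxu) (hp.odd_of_ne_two hp2) (Or.inr hp)
    (by rw [hdeg, add_comm]) hA

/-! ## §3 Shape Dic: dicyclic — GOOD for all abelian varieties -/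

omit [IsCMField K] in
/-- **Shape Dic ⟹ `Gal(K/ℚ) ≃* Dic_{2^k p}`** (`[K:ℚ] = 2^{k+2}·p`; `u` of odd prime order `p`, `a` of order `2^{k+1}` centralising `u`, `x`
inverting `u`, `x a = a⁻¹ x`, `x² = a^{2^k}`). [cite: Rotman1995, Thm. 4.3] -/
theorem nonempty_mulEquiv_quaternionGroup_of_shape_dic {k p : ℕ} (hdeg : Module.finrank ℚ K = 2 ^ (k + 2) * p)
    (hp : p.Prime) (hp2 : p ≠ 2) {u a x : K ≃ₐ[ℚ] K} (hou : orderOf u = p) (hoa : orderOf a = 2 ^ (k + 1))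
    (hua : a * u * a⁻¹ = u) (hxu : x * u * x⁻¹ = u⁻¹) (hxa : x * a = a⁻¹ * x) (hxx : x * x = a ^ 2 ^ k) :
    Nonempty ((K ≃ₐ[ℚ] K) ≃* QuaternionGroup (2 ^ k * p)) :=
  nonempty_mulEquiv_quaternionGroup_of_dic_relations hp hp2 hou hoa hua hxu hxa hxx
    (by rw [IsGalois.card_aut_eq_finrank, hdeg])

/-- **Shape Dic is GOOD for ALL abelian varieties: the Hodge conjecture for every power of every abelian variety with CM by `K`.**
[cite: Shimura1998, §5.1 Prop. 3, §6.2 Thm. 3 and §8.2 Prop. 26] [cite: Gordon1999HodgeAVSurvey, Thm. 6.4 and §9.4.3]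
[cite: Kubota1965, §4 Lemma 2] -/
theorem hodgeConjectureFor_pow_of_shape_dic {k p : ℕ} (hdeg : Module.finrank ℚ K = 2 ^ (k + 2) * p) (hp : p.Prime)
    (hp2 : p ≠ 2) {u a x : K ≃ₐ[ℚ] K} (hou : orderOf u = p) (hoa : orderOf a = 2 ^ (k + 1)) (hua : a * u * a⁻¹ = u)
    (hxu : x * u * x⁻¹ = u⁻¹) (hxa : x * a = a⁻¹ * x) (hxx : x * x = a ^ 2 ^ k) (hA : IsCMTypeRealisation Φ A ι θ)
    (N : ℕ) : HodgeConjectureFor (⨁ fun _ : Fin N => A).dim (⨁ fun _ : Fin N => A).X := by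
  haveI : NeZero (2 ^ k * p) := ⟨Nat.pos_iff_ne_zero.1 (Nat.mul_pos (pow_pos two_pos _) hp.pos)⟩
  obtain ⟨e⟩ := nonempty_mulEquiv_quaternionGroup_of_shape_dic hdeg hp hp2 hou hoa hua hxu hxa hxx
  exact GaloisDicyclic.hodgeConjectureFor_pow_dicyclic (n := 2 ^ k * p) rfl hp hp2 e hA N

/-- … and every abelian variety realising a CM type of `K` is STABLY NONDEGENERATE. [cite: Gordon1999HodgeAVSurvey, Thm. 6.4]
[cite: Kubota1965, §4 Lemma 2] -/
theorem isStablyNondegenerate_of_shape_dic {k p : ℕ} (hdeg : Module.finrank ℚ K = 2 ^ (k + 2) * p) (hp : p.Prime)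
    (hp2 : p ≠ 2) {u a x : K ≃ₐ[ℚ] K} (hou : orderOf u = p) (hoa : orderOf a = 2 ^ (k + 1)) (hua : a * u * a⁻¹ = u)
    (hxu : x * u * x⁻¹ = u⁻¹) (hxa : x * a = a⁻¹ * x) (hxx : x * x = a ^ 2 ^ k) (hA : IsCMTypeRealisation Φ A ι θ) :
    IsStablyNondegenerate A := by
  haveI : NeZero (2 ^ k * p) := ⟨Nat.pos_iff_ne_zero.1 (Nat.mul_pos (pow_pos two_pos _) hp.pos)⟩
  obtain ⟨e⟩ := nonempty_mulEquiv_quaternionGroup_of_shape_dic hdeg hp hp2 hou hoa hua hxu hxa hxx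
  exact GaloisDicyclic.isStablyNondegenerate_of_isCMTypeRealisation_dicyclic (n := 2 ^ k * p) rfl hp hp2 e hA

end Summit.HodgeConjecture.CorCM.GaloisModels

end
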